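import Mathlib
import Literature.Barriers.ValiantsHypothesis.AlgebraicNaturalProofs
import Literature.Computability.AlgebraicComplexity.ArithCircuitProofs
import Literature.Computability.AlgebraicComplexity.RazUniversalCircuits
import Summits.ValiantsHypothesis.ValiantsHypothesis.Theorems.DivisionGapZeroOneTransferStubSqrtCheap
import Summits.ValiantsHypothesis.ValiantsHypothesis.Theorems.BarrierLeverSuccinctHittingSetsForVPLevelOne
import Summits.ValiantsHypothesis.ValiantsHypothesis.Theorems.BarrierLeverSuccinctHittingSetsForVPDimensionCount
import Summits.ValiantsHypothesis.ValiantsHypothesis.Theorems.BarrierLeverSuccinctHittingSetsForVPLowDegreeEquations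
import Summits.ValiantsHypothesis.ValiantsHypothesis.Theorems.BarrierLeverSuccinctHittingSetsForVPUniversalSize
import HarnessLib

/-!
# Crux `BarrierLever.SuccinctHittingSetsForVP` (stmt-ValiantsHypothesis-14610), line `registered` —
THE CRUX AS A STATEMENT ABOUT ONE POLYNOMIAL MAP: level one ⟺ a polynomially invertible generator
fools the level-one distinguishers (FSV 2018, universal circuits ⟹ succinct generators)

**What is proved (unconditional; an EQUIVALENT form of the open stub `stub_levelOne`, it does NOT
close the item).**

* `exists_generator` (registered stub `stub_generator`): for every `b` and `n ≥ 1` there is a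
  polynomial map `G : ℂ^p → ℂ^N` (`N = C(2n,n)` coordinates indexed by `degLEMonomials n`,
  `p ≤ 9376 (n+3)^(5b+21)`, coordinates of degree `≤ 2n`) which is
  (i) ONTO the simple class — `coeff(f) ∈ G(ℂ^p)` for every `f ∈ SmallCircuits ℂ n b` — and
  (ii) INTO a slightly larger simple class — every value `G(y)` is `coeff(f)` for some `f` of
  degree `≤ n` and size `L(f) ≤ 21876 (n+3)^(5b+21)`.
  (`G(c₀, y₁, …, y_n) = coeff(c₀ + Σ_k OUT_k(y_k))`, one copy of Raz's universal circuit-graph per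
  degree `k`: (i) is Raz 2010 Prop. 3.3 applied to the homogeneous components, (ii) is the size and
  homogeneity of the universal outputs, `UniversalSize.complexity_outVal_le`.)
* `levelOne_iff_generator` : FSV Question 6 at level one (`stub_levelOne`) holds IFF for some `b`,
  eventually in `n`, some polynomial map `G` INTO `coeff(SmallCircuits ℂ n b)` FOOLS NO level-one
  distinguisher: `D ∘ G ≠ 0` in `ℂ[y]` for every nonzero `D ∈ Distinguishers ℂ n 1`;
* `succinctHittingSetsForVP_iff_generator` : hence the route's crux (↔ level one, landed
  `succinctHittingSetsForVP_iff_levelOne`) is equivalent to that generator statement.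

So the crux is the assertion that the explicit low-degree map `G_{n,b}` is a hitting-set GENERATOR
with `polylog(N)` seed length for `N`-size-and-degree circuits (FSV Cor. 5 / Question 6 in
generator form); a disproof is a nonzero small `D` with `D ∘ G_{n,b} = 0` for every `b`
(infinitely often in `n`), a proof is a `b` for which no small `D` annihilates `G_{n,b}`.
Axioms: `propext`, `Classical.choice`, `Quot.sound`.

References: [ForbesShpilkaVolk2018] §1.3, §3 (universal circuits and succinct generators), Thm. 4,
Cor. 5, Question 6; [Raz2010] Prop. 2.8, 3.2, 3.3.
-/

-- layout Summits/ValiantsHypothesis/ValiantsHypothesis forces the duplicated namespace component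
set_option linter.dupNamespace false

namespace Summit.ValiantsHypothesis.ValiantsHypothesis.Theorems.BarrierLever.SuccinctHittingSetsForVP

open Literature.Barriers.ValiantsHypothesis Literature.Computability.AlgebraicComplexity MvPolynomial

namespace Generator

/-- Evaluating a polynomial in the coefficient variables at a value of a map `G`:
`D(G(y)) = (D ∘ G)(y)`. [folklore] -/
theorem eval_point_eq {n p : ℕ} (G : degLEMonomials n → MvPolynomial (Fin p) ℂ) (y : Fin p → ℂ)
    (D : MvPolynomial (degLEMonomials n) ℂ) :
    eval (fun m => eval y (G m)) D = eval y (aeval G D) :=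
  (LowDegreeEquations.eval_comp_aeval y G D).symm

/-- A nonzero polynomial over `ℂ` has a non-root. [folklore] -/
theorem exists_eval_ne_zero {p : ℕ} {Q : MvPolynomial (Fin p) ℂ} (hQ : Q ≠ 0) :
    ∃ y : Fin p → ℂ, eval y Q ≠ 0 := by
  by_contra h
  push Not at h
  exact hQ (MvPolynomial.funext fun y => by simpa using h y)

/-- Arithmetic for the parameter count and the size of the range polynomials. [folklore] -/
theorem bounds (n b : ℕ) :
    3 * (n + n + 4 * ((n + 1) * (n ^ b + n + 2)) * (n + 1) ^ 2 + 1) ^ 5 ≤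
        9375 * (n + 3) ^ (5 * b + 20) ∧
      7 * (n + n + 4 * ((n + 1) * (n ^ b + n + 2)) * (n + 1) ^ 2 + 1) ^ 5 ≤
        21875 * (n + 3) ^ (5 * b + 20) := by
  have h := LowDegreeEquations.slots_le n b
  have h5 : (n + n + 4 * ((n + 1) * (n ^ b + n + 2)) * (n + 1) ^ 2 + 1) ^ 5 ≤
      3125 * (n + 3) ^ (5 * b + 20) := by
    calc (n + n + 4 * ((n + 1) * (n ^ b + n + 2)) * (n + 1) ^ 2 + 1) ^ 5
        ≤ (5 * (n + 3) ^ (b + 4)) ^ 5 := Nat.pow_le_pow_left h 5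
      _ = 3125 * (n + 3) ^ (5 * b + 20) := by rw [mul_pow, ← pow_mul]; ring
  constructor <;> omega

end Generator

open Generator

/-- **The generator (onto the class `b`, into a polynomially larger class).** For `b` and `n ≥ 1`:
a polynomial map `G` on `p ≤ 9376 (n+3)^(5b+21)` parameters with coordinates of degree `≤ 2n`,
whose image contains `coeff(SmallCircuits ℂ n b)` and is contained in the coefficient vectors of
degree-`≤ n` polynomials of size `≤ 21876 (n+3)^(5b+21)`.
[cite: ForbesShpilkaVolk2018, §3; Raz2010, Prop. 3.3 (p. 158)] -/
theorem exists_generator (b n : ℕ) (hn : 1 ≤ n) :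
    ∃ (p : ℕ) (G : degLEMonomials n → MvPolynomial (Fin p) ℂ),
      p ≤ 9376 * (n + 3) ^ (5 * b + 21) ∧ (∀ m, (G m).totalDegree ≤ 2 * n) ∧
      (∀ f ∈ SmallCircuits ℂ n b, ∃ y : Fin p → ℂ, ∀ m,
        eval y (G m) = coeff (m : Fin n →₀ ℕ) f) ∧
      (∀ y : Fin p → ℂ, ∃ f : MvPolynomial (Fin n) ℂ, f.totalDegree ≤ n ∧
        complexity f ≤ 21876 * (n + 3) ^ (5 * b + 21) ∧
        ∀ m : degLEMonomials n, coeff (m : Fin n →₀ ℕ) f = eval y (G m)) := by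
  classical
  -- parameters: one universal circuit-graph per degree `k : Fin (n + 1)` (unused for `k = 0`)
  set s := (n + 1) * (n ^ b + n + 2) with hs
  set W := 4 * s * (n + 1) ^ 2 with hW
  let L : Fin (n + 1) → Type := fun k => RazUniversal.Lab (Fin n) (k : ℕ) W
  let P := Unit ⊕ (Σ k : Fin (n + 1), L k)
  let lvl : degLEMonomials n → Fin (n + 1) := fun m =>
    ⟨(m : Fin n →₀ ℕ).degree, Nat.lt_succ_of_le m.2⟩
  let G₀ : degLEMonomials n → MvPolynomial P ℂ := fun m =>
    if (m : Fin n →₀ ℕ).degree = 0 then X (Sum.inl ())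
    else rename (fun l : L (lvl m) => (Sum.inr ⟨lvl m, l⟩ : P))
      (RazUniversal.uCoeff ℂ (Fin n) (lvl m : ℕ) W (m : Fin n →₀ ℕ))
  let e := Fintype.equivFin P
  obtain ⟨hb1, hb2⟩ := bounds n b
  have hlab : ∀ k : Fin (n + 1), Fintype.card (L k) ≤ 9375 * (n + 3) ^ (5 * b + 20) := by
    intro k
    refine (RazUniversal.card_lab_le (Fin n) k W).trans (le_trans ?_ hb1)
    rw [Fintype.card_fin]
    have hk : (k : ℕ) ≤ n := Nat.lt_succ_iff.mp k.isLt
    gcongr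
  refine ⟨Fintype.card P, fun m => rename e (G₀ m), ?_, ?_, ?_, ?_⟩
  · -- parameter count
    have hP : Fintype.card P = 1 + ∑ k : Fin (n + 1), Fintype.card (L k) := by
      simp [P, Fintype.card_sum, Fintype.card_sigma]
    rw [hP]
    have h1 : 1 ≤ (n + 3) ^ (5 * b + 21) := Nat.one_le_pow _ _ (by omega)
    calc 1 + ∑ k : Fin (n + 1), Fintype.card (L k)
        ≤ 1 + ∑ _k : Fin (n + 1), 9375 * (n + 3) ^ (5 * b + 20) := by
          gcongr with k; exact hlab k
      _ = 1 + (n + 1) * (9375 * (n + 3) ^ (5 * b + 20)) := by simp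
      _ ≤ 1 + (n + 3) * (9375 * (n + 3) ^ (5 * b + 20)) := by gcongr; omega
      _ = 1 + 9375 * (n + 3) ^ (5 * b + 21) := by ring
      _ ≤ 9376 * (n + 3) ^ (5 * b + 21) := by omega
  · -- degrees
    intro m
    refine (totalDegree_rename_le _ _).trans ?_
    simp only [G₀]
    split_ifs
    · rw [totalDegree_X]; omega
    · exact (totalDegree_rename_le _ _).trans
        ((RazUniversal.totalDegree_uCoeff_le _).trans (by omega))
  · -- onto the class `b`
    intro f hf
    have hlabels : ∀ k : Fin (n + 1), ∃ y : L k → ℂ, 1 ≤ (k : ℕ) →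
        ∀ e', eval y (RazUniversal.uCoeff ℂ (Fin n) (k : ℕ) W e') =
          coeff e' (homogeneousComponent (k : ℕ) f) := by
      intro k
      by_cases hk : 1 ≤ (k : ℕ)
      · have hkn : (k : ℕ) ≤ n := Nat.lt_succ_iff.mp k.isLt
        have hg : (homogeneousComponent (k : ℕ) f).IsHomogeneous (k : ℕ) :=
          homogeneousComponent_isHomogeneous _ _
        have hgc : complexity (homogeneousComponent (k : ℕ) f) ≤ s := by
          have h1 := Summit.ValiantsHypothesis.ValiantsHypothesis.Theorems.DivisionGapZeroOneTransfer.SqrtCheap.complexity_homogeneousComponent_le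
            f hf.1 (k : ℕ)
          rw [Fintype.card_fin] at h1
          exact h1.trans (Nat.mul_le_mul_left _ (by have := hf.2; omega))
        have hN : 4 * s * ((k : ℕ) + 1) ^ 2 ≤ W := by rw [hW]; gcongr
        obtain ⟨y, hy⟩ := RazUniversal.exists_eval_uCoeff_eq_coeff (R := ℂ) (σ := Fin n)
          (r := (k : ℕ)) (N := W) (s := s) hk hN hg hgc
        exact ⟨y, fun _ => hy⟩
      · exact ⟨fun _ => 0, fun h => absurd h hk⟩
    choose y hy using hlabels
    let Y : P → ℂ := Sum.elim (fun _ => coeff 0 f) (fun kl => y kl.1 kl.2)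
    refine ⟨Y ∘ e.symm, fun m => ?_⟩
    rw [eval_rename, Function.comp_assoc, Equiv.symm_comp_self, Function.comp_id]
    simp only [G₀]
    split_ifs with h0
    · rw [eval_X]
      have hm0 : (m : Fin n →₀ ℕ) = 0 := (Finsupp.degree_eq_zero_iff _).mp h0
      simp [Y, hm0]
    · rw [eval_rename]
      have hk1 : 1 ≤ ((lvl m : Fin (n + 1)) : ℕ) := Nat.one_le_iff_ne_zero.mpr h0
      have hcomp : Y ∘ (fun l : L (lvl m) => (Sum.inr ⟨lvl m, l⟩ : P)) = y (lvl m) := by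
        funext l; simp [Y]
      rw [hcomp, hy (lvl m) hk1]
      simp only [lvl]
      rw [coeff_homogeneousComponent, if_pos rfl]
  · -- into a larger class: every value is the coefficient vector of `c₀ + Σ_k OUT_k(y_k)`
    intro y'
    let Y : P → ℂ := y' ∘ e
    let g : Fin (n + 1) → MvPolynomial (Fin n) ℂ := fun k =>
      if 1 ≤ (k : ℕ) then RazUniversal.outVal (fun l : L k => Y (Sum.inr ⟨k, l⟩)) else 0
    have hghom : ∀ k : Fin (n + 1), (g k).IsHomogeneous (k : ℕ) := by
      intro k
      simp only [g]
      split_ifs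
      · exact UniversalSize.isHomogeneous_outVal _
      · exact isHomogeneous_zero _ _ _
    have hgc : ∀ k : Fin (n + 1), complexity (g k) ≤ 21875 * (n + 3) ^ (5 * b + 20) := by
      intro k
      simp only [g]
      split_ifs
      · refine (UniversalSize.complexity_outVal_le_poly _).trans (le_trans ?_ hb2)
        have hk : (k : ℕ) ≤ n := Nat.lt_succ_iff.mp k.isLt
        gcongr
      · have : complexity (0 : MvPolynomial (Fin n) ℂ) = 0 := by
          simpa using complexity_C_holds (σ := Fin n) (0 : ℂ)
        omega
    refine ⟨C (Y (Sum.inl ())) + ∑ k, g k, ?_, ?_, fun m => ?_⟩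
    · -- degree
      refine (totalDegree_add _ _).trans (max_le (by rw [totalDegree_C]; exact Nat.zero_le _) ?_)
      refine totalDegree_finsetSum_le fun k _ => (hghom k).totalDegree_le.trans ?_
      exact Nat.lt_succ_iff.mp k.isLt
    · -- size
      have h1 : 1 ≤ (n + 3) ^ (5 * b + 20) := Nat.one_le_pow _ _ (by omega)
      calc complexity (C (Y (Sum.inl ())) + ∑ k, g k)
          ≤ complexity (C (Y (Sum.inl ())) : MvPolynomial (Fin n) ℂ) + complexity (∑ k, g k) + 1 :=
            complexity_add_le_holds _ _
        _ ≤ 0 + (∑ k, complexity (g k) + (Finset.univ : Finset (Fin (n + 1))).card) + 1 := by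
            rw [complexity_C_holds]
            gcongr
            exact complexity_finset_sum_le _ _
        _ ≤ 0 + (∑ _k : Fin (n + 1), 21875 * (n + 3) ^ (5 * b + 20) +
              (Finset.univ : Finset (Fin (n + 1))).card) + 1 := by
            gcongr with k; exact hgc k
        _ = (n + 1) * (21875 * (n + 3) ^ (5 * b + 20)) + (n + 1) + 1 := by simp
        _ ≤ (n + 3) * (21875 * (n + 3) ^ (5 * b + 20)) + (n + 3) * (n + 3) ^ (5 * b + 20) := by
            nlinarith
        _ = 21876 * (n + 3) ^ (5 * b + 21) := by ring
    · -- coefficients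
      rw [eval_rename]
      change coeff (m : Fin n →₀ ℕ) (C (Y (Sum.inl ())) + ∑ k, g k) = eval Y (G₀ m)
      rw [coeff_add, coeff_sum, coeff_C]
      simp only [G₀]
      -- only the summand `k = deg m` survives
      have hsum : ∑ k : Fin (n + 1), coeff (m : Fin n →₀ ℕ) (g k) =
          coeff (m : Fin n →₀ ℕ) (g (lvl m)) := by
        refine Finset.sum_eq_single (lvl m) (fun k _ hk => ?_) (fun h => absurd (Finset.mem_univ _) h)
        refine (hghom k).coeff_eq_zero ?_
        intro hdeg
        exact hk (Fin.ext (by simp only [lvl]; exact hdeg.symm))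
      rw [hsum]
      by_cases h0 : (m : Fin n →₀ ℕ).degree = 0
      · have hm0 : (m : Fin n →₀ ℕ) = 0 := (Finsupp.degree_eq_zero_iff _).mp h0
        rw [if_pos h0, if_pos hm0.symm, eval_X]
        have hlt : ¬ (1 ≤ ((lvl m : Fin (n + 1)) : ℕ)) := by simp only [lvl]; omega
        have : g (lvl m) = 0 := by simp only [g]; rw [if_neg hlt]
        rw [this, coeff_zero, add_zero]
      · have hm0 : (0 : Fin n →₀ ℕ) ≠ (m : Fin n →₀ ℕ) := by
          intro h; apply h0; rw [← h]; simp
        rw [if_neg h0, if_neg hm0, zero_add, eval_rename]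
        have hk1 : 1 ≤ ((lvl m : Fin (n + 1)) : ℕ) := Nat.one_le_iff_ne_zero.mpr h0
        have hg : g (lvl m) = RazUniversal.outVal (fun l : L (lvl m) => Y (Sum.inr ⟨lvl m, l⟩)) := by
          simp only [g]; rw [if_pos hk1]
        rw [hg, RazUniversal.coeff_outVal]
        rfl

/-- **Registered stub `stub_generator`** (crux stmt-ValiantsHypothesis-14610, line `registered`;
STRUCTURE of the open stub `stub_levelOne`): the polynomially invertible generator of the simple
class — onto `coeff(SmallCircuits ℂ n b)`, into the coefficient vectors of degree-`≤ n` polynomials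
of size `≤ 21876 (n+3)^(5b+21)`. [cite: ForbesShpilkaVolk2018, §3; Raz2010, Prop. 3.3] -/
theorem stub_generator :
    ∀ b n : ℕ, 1 ≤ n →
      ∃ (p : ℕ) (G : degLEMonomials n → MvPolynomial (Fin p) ℂ),
        p ≤ 9376 * (n + 3) ^ (5 * b + 21) ∧ (∀ m, (G m).totalDegree ≤ 2 * n) ∧
        (∀ f ∈ SmallCircuits ℂ n b, ∃ y : Fin p → ℂ, ∀ m,
          MvPolynomial.eval y (G m) = MvPolynomial.coeff (m : Fin n →₀ ℕ) f) ∧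
        (∀ y : Fin p → ℂ, ∃ f : MvPolynomial (Fin n) ℂ, f.totalDegree ≤ n ∧
          complexity f ≤ 21876 * (n + 3) ^ (5 * b + 21) ∧
          ∀ m : degLEMonomials n, MvPolynomial.coeff (m : Fin n →₀ ℕ) f = MvPolynomial.eval y (G m)) :=
  exists_generator

/-- **Level one ⟺ a generator into the simple class fools no level-one distinguisher.**
FSV Question 6 at level one holds iff for some `b`, eventually in `n`, there is a polynomial map
`G` with values in `coeff(SmallCircuits ℂ n b)` such that `D ∘ G ≠ 0` for every nonzero
`D ∈ Distinguishers ℂ n 1`. (`⇐`: a non-root `y` of `D ∘ G` gives the hitting polynomial with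
coefficient vector `G(y)`; `⇒`: the generator of `exists_generator` for the hitting class `b` is onto
it, so a hitting `f` gives `(D ∘ G)(y) = D(coeff f) ≠ 0`, and its values lie in the class
`5b + 22`.) [cite: ForbesShpilkaVolk2018, Thm. 4, Cor. 5 and Question 6] -/
theorem levelOne_iff_generator :
    (∃ b n₀ : ℕ, ∀ n : ℕ, n₀ ≤ n →
      IsSuccinctHittingSet (degLEMonomials n) (SmallCircuits ℂ n b) (Distinguishers ℂ n 1)) ↔
    (∃ b n₀ : ℕ, ∀ n : ℕ, n₀ ≤ n →
      ∃ (p : ℕ) (G : degLEMonomials n → MvPolynomial (Fin p) ℂ),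
        (∀ y : Fin p → ℂ, ∃ f ∈ SmallCircuits ℂ n b, ∀ m : degLEMonomials n,
          coeff (m : Fin n →₀ ℕ) f = eval y (G m)) ∧
        ∀ D ∈ Distinguishers ℂ n 1, D ≠ 0 → aeval G D ≠ 0) := by
  constructor
  · rintro ⟨b, n₀, hhit⟩
    -- the range polynomials of the generator for the class `b` have size `≤ n^(5b+22)` eventually
    set A := 21876 * 2 ^ (5 * b + 21) with hA
    refine ⟨5 * b + 22, max (max n₀ A) 3, fun n hn => ?_⟩
    have hn₀ : n₀ ≤ n := le_trans (le_max_left _ _) ((le_max_left _ _).trans hn)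
    have hnA : A ≤ n := le_trans (le_max_right _ _) ((le_max_left _ _).trans hn)
    have hn3 : 3 ≤ n := (le_max_right _ _).trans hn
    obtain ⟨p, G, -, -, honto, hinto⟩ := exists_generator b n (by omega)
    refine ⟨p, G, fun y => ?_, fun D hD hD0 => ?_⟩
    · obtain ⟨f, hfd, hfc, hcoeff⟩ := hinto y
      refine ⟨f, ⟨hfd, hfc.trans ?_⟩, hcoeff⟩
      have h2 : (n + 3) ^ (5 * b + 21) ≤ (2 * n) ^ (5 * b + 21) := Nat.pow_le_pow_left (by omega) _
      calc 21876 * (n + 3) ^ (5 * b + 21) ≤ 21876 * (2 * n) ^ (5 * b + 21) :=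
            Nat.mul_le_mul_left _ h2
        _ = A * n ^ (5 * b + 21) := by rw [hA, mul_pow]; ring
        _ ≤ n * n ^ (5 * b + 21) := Nat.mul_le_mul_right _ hnA
        _ = n ^ (5 * b + 22) := by ring
    · obtain ⟨f, hf, hne⟩ := hhit n hn₀ D hD hD0
      obtain ⟨y, hy⟩ := honto f hf
      have hpt : coeffVector (degLEMonomials n) f = fun m => eval y (G m) := by
        funext m; rw [coeffVector_apply, hy]
      rw [hpt, eval_point_eq] at hne
      exact fun h0 => hne (by rw [h0, map_zero])
  · rintro ⟨b, n₀, hgen⟩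
    refine ⟨b, n₀, fun n hn D hD hD0 => ?_⟩
    obtain ⟨p, G, hinto, hfool⟩ := hgen n hn
    obtain ⟨y, hy⟩ := exists_eval_ne_zero (hfool D hD hD0)
    obtain ⟨f, hf, hcoeff⟩ := hinto y
    refine ⟨f, hf, ?_⟩
    have hpt : coeffVector (degLEMonomials n) f = fun m => eval y (G m) := by
      funext m; rw [coeffVector_apply, hcoeff]
    rwa [hpt, eval_point_eq]

/-- **The route's crux in generator form.** `BarrierLever.SuccinctHittingSetsForVP` (FSV Question 6
over `ℂ`, every level) holds iff for some `b`, eventually in `n`, a polynomial map into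
`coeff(SmallCircuits ℂ n b)` is annihilated by no nonzero level-one distinguisher.
[cite: ForbesShpilkaVolk2018, Cor. 5 and Question 6] -/
theorem succinctHittingSetsForVP_iff_generator :
    Summit.ValiantsHypothesis.ValiantsHypothesis.Theses.BarrierLever.SuccinctHittingSetsForVP ↔
    (∃ b n₀ : ℕ, ∀ n : ℕ, n₀ ≤ n →
      ∃ (p : ℕ) (G : degLEMonomials n → MvPolynomial (Fin p) ℂ),
        (∀ y : Fin p → ℂ, ∃ f ∈ SmallCircuits ℂ n b, ∀ m : degLEMonomials n,
          coeff (m : Fin n →₀ ℕ) f = eval y (G m)) ∧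
        ∀ D ∈ Distinguishers ℂ n 1, D ≠ 0 → aeval G D ≠ 0) :=
  succinctHittingSetsForVP_iff_levelOne.trans levelOne_iff_generator

end Summit.ValiantsHypothesis.ValiantsHypothesis.Theorems.BarrierLever.SuccinctHittingSetsForVP
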